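import Mathlib
import Summits.Ventures.PercRepro2.Harris
import Summits.Ventures.PercRepro2.BasePrime
import Summits.Ventures.PercRepro2.LocRows
import Summits.Ventures.PercRepro2.SwRow

/-!
# The cube principle for (SW)-type dominations (blind cell PercRepro2, night-4 g9, 2026-08-25;
proofs/NIGHT4-G9.md §8, §8′)

The mechanism behind the star classes of statement (HLC), stated once and for all: a class of
configurations that is the injective image `r '' univ` of a CUBE `Config E'` (uniform), on which

* the red cluster of `h` is INCREASING in the cube colouring and the blue cluster DECREASING
  (`hT`, `hTp`), and the global flip of the cube exchanges them (`hswap`);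
* the conditioning event (the pull-back of `Qs`) is a LOWER set of the cube (`hEv`),

satisfies, for every up-set `𝓥`, `#(class ∩ Qs ∩ {C_R(h) ∈ 𝓥}) ≤ #(class ∩ Qs ∩ {C_B(h) ∈ 𝓥})`
(`card_le_of_cube`: two Harris inequalities on the cube and the flip), hence (Hall,
`exists_sw_injection_of_card_le_cube`) an injection of `class ∩ Qs` into itself carrying `C_R(h)`
into `C_B(h)` of the image.  The star classes (SwOutStar) and the tree classes (paper, §8′) are
instances; any union of disjoint instances is an instance.
-/

namespace Summit.Ventures.PercRepro2

namespace LocRows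

open Hull

variable {V : Type*} {E : Type*} [Fintype E] [DecidableEq E]

open scoped Classical

variable {ends : E → Sym2 V}

/-- The uniform probability of an event of a cube is its size over `2^d`. -/
lemma prob_half_eq_card' {E' : Type*} [Fintype E'] [DecidableEq E'] (A : Set (Config E')) :
    prob (half (E := E') (R := ℚ)) A =
      (1 / 2 : ℚ) ^ Fintype.card E' * ((Finset.univ.filter (· ∈ A)).card : ℚ) := by
  rw [prob_eq_sum_filter]
  simp only [weight_half, Finset.sum_const, nsmul_eq_mul]
  ring

/-- **Harris on a cube**: for a lower set `Ev`, an up-set `A` and a lower set `B` of the cube with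
`flipAll ⁻¹' B = A` (the flip exchanges them), `#(Ev ∩ A) ≤ #(Ev ∩ B)`. -/
theorem card_inter_le_of_cube {E' : Type*} [Fintype E'] [DecidableEq E'] {Ev A B : Set (Config E')}
    (hEv : IsLowerSet Ev) (hA : IsUpperSet A) (hB : IsLowerSet B) (hAB : flipAll ⁻¹' B = A) :
    (Finset.univ.filter (· ∈ Ev ∩ A)).card ≤ (Finset.univ.filter (· ∈ Ev ∩ B)).card := by
  have hp : IsProbVec (half (E := E') (R := ℚ)) := isProbVec_half
  have h1 := prob_inter_le_prob_mul_prob_of_isLowerSet hp hEv hA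
  have h2 := prob_mul_prob_le_prob_inter_of_isLowerSet hp hEv hB
  have h3 : prob (half (E := E') (R := ℚ)) A = prob half B := by
    rw [← hAB, prob_half_flipAll]
  have key : prob (half (E := E') (R := ℚ)) (Ev ∩ A) ≤ prob half (Ev ∩ B) := by
    calc prob (half (E := E') (R := ℚ)) (Ev ∩ A) ≤ prob half Ev * prob half A := h1
      _ = prob half Ev * prob half B := by rw [h3]
      _ ≤ prob half (Ev ∩ B) := h2
  rw [prob_half_eq_card', prob_half_eq_card'] at key
  have hpos : (0 : ℚ) < (1 / 2 : ℚ) ^ Fintype.card E' := by positivity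
  have h4 := le_of_mul_le_mul_left key hpos
  norm_cast at h4
  convert h4

omit [DecidableEq E] in
/-- **The cube principle**: a class `C = r '' univ` of an injective realisation `r` of a cube, on
which the red cluster of `h` is increasing, the blue cluster decreasing, the flip exchanges them, and
the conditioning `Qs` pulls back to a lower set; then the counting inequality of (SW) holds on
`C ∩ Qs` for every up-set `𝓥`. -/
theorem card_le_of_cube {E' : Type*} [Fintype E'] [DecidableEq E'] (r : Config E' → Config E)
    (hr : Function.Injective r) (C : Finset (Config E)) (hC : ∀ ζ, ζ ∈ C ↔ ∃ ω, r ω = ζ)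
    (Qs : Set (Config E)) (hEv : IsLowerSet {ω | r ω ∈ Qs}) (h : V)
    (hT : ∀ 𝓥 : Set (Set V), IsUpperSet 𝓥 → IsUpperSet {ω | cluster ends (r ω) h ∈ 𝓥})
    (hTp : ∀ 𝓥 : Set (Set V), IsUpperSet 𝓥 → IsLowerSet {ω | cluster ends (blue (r ω)) h ∈ 𝓥})
    (hswap : ∀ ω, cluster ends (r (flipAll ω)) h = cluster ends (blue (r ω)) h)
    {𝓥 : Set (Set V)} (h𝓥 : IsUpperSet 𝓥) :
    (C.filter fun ζ => ζ ∈ Qs ∧ cluster ends ζ h ∈ 𝓥).card ≤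
      (C.filter fun ζ => ζ ∈ Qs ∧ cluster ends (blue ζ) h ∈ 𝓥).card := by
  -- the class pieces are images of the cube pieces
  have e1 : (C.filter fun ζ => ζ ∈ Qs ∧ cluster ends ζ h ∈ 𝓥) =
      (Finset.univ.filter fun ω => r ω ∈ Qs ∧ cluster ends (r ω) h ∈ 𝓥).image r := by
    ext ζ
    simp only [Finset.mem_filter, Finset.mem_image, Finset.mem_univ, true_and]
    constructor
    · rintro ⟨hζ, hP⟩
      obtain ⟨ω, rfl⟩ := (hC ζ).1 hζ
      exact ⟨ω, hP, rfl⟩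
    · rintro ⟨ω, hP, rfl⟩
      exact ⟨(hC _).2 ⟨ω, rfl⟩, hP⟩
  have e2 : (C.filter fun ζ => ζ ∈ Qs ∧ cluster ends (blue ζ) h ∈ 𝓥) =
      (Finset.univ.filter fun ω => r ω ∈ Qs ∧ cluster ends (blue (r ω)) h ∈ 𝓥).image r := by
    ext ζ
    simp only [Finset.mem_filter, Finset.mem_image, Finset.mem_univ, true_and]
    constructor
    · rintro ⟨hζ, hP⟩
      obtain ⟨ω, rfl⟩ := (hC ζ).1 hζ
      exact ⟨ω, hP, rfl⟩
    · rintro ⟨ω, hP, rfl⟩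
      exact ⟨(hC _).2 ⟨ω, rfl⟩, hP⟩
  rw [e1, e2, Finset.card_image_of_injective _ hr, Finset.card_image_of_injective _ hr]
  have hAB : flipAll ⁻¹' {ω | cluster ends (blue (r ω)) h ∈ 𝓥} =
      {ω | cluster ends (r ω) h ∈ 𝓥} := by
    ext ω
    simp only [Set.mem_preimage, Set.mem_setOf_eq, ← hswap, flipAll_involutive ω]
  have := card_inter_le_of_cube hEv (hT 𝓥 h𝓥) (hTp 𝓥 h𝓥) hAB
  convert this using 2 <;> ext ω <;>
    simp only [Finset.mem_filter, Finset.mem_univ, true_and, Set.mem_inter_iff, Set.mem_setOf_eq]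

omit [DecidableEq E] in
/-- Hall for the (SW) relation on an arbitrary finite set of configurations. -/
theorem exists_sw_injection_of_card_le' (h : V) (Q₀ : Finset (Config E))
    (hc : ∀ 𝓥 : Set (Set V), IsUpperSet 𝓥 →
      (Q₀.filter fun ζ => cluster ends ζ h ∈ 𝓥).card ≤
        (Q₀.filter fun ζ => cluster ends (blue ζ) h ∈ 𝓥).card) :
    ∃ f : {ζ // ζ ∈ Q₀} → Config E, Function.Injective f ∧
      ∀ x, f x ∈ Q₀ ∧ cluster ends x.1 h ⊆ cluster ends (blue (f x)) h := by
  let t : {ζ // ζ ∈ Q₀} → Finset (Config E) := fun x =>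
    Q₀.filter fun ζ' => cluster ends x.1 h ⊆ cluster ends (blue ζ') h
  have hall : ∀ s : Finset {ζ // ζ ∈ Q₀}, s.card ≤ (s.biUnion t).card := by
    intro s
    let 𝓥 : Set (Set V) := {S | ∃ x ∈ s, cluster ends x.1 h ⊆ S}
    have h𝓥 : IsUpperSet 𝓥 := by
      intro S S' hSS' ⟨x, hx, hxS⟩
      exact ⟨x, hx, hxS.trans hSS'⟩
    have e1 : s.biUnion t = Q₀.filter fun ζ' => cluster ends (blue ζ') h ∈ 𝓥 := by
      ext ζ'
      simp only [Finset.mem_biUnion, Finset.mem_filter, t, 𝓥, Set.mem_setOf_eq]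
      constructor
      · rintro ⟨x, hx, hζ', hsub⟩
        exact ⟨hζ', x, hx, hsub⟩
      · rintro ⟨hζ', x, hx, hsub⟩
        exact ⟨x, hx, hζ', hsub⟩
    have e2 : s.card ≤ (Q₀.filter fun ζ => cluster ends ζ h ∈ 𝓥).card := by
      refine Finset.card_le_card_of_injOn (fun x => x.1) ?_ ?_
      · intro x hx
        rw [Finset.mem_coe] at hx
        simp only [Finset.mem_coe, Finset.mem_filter]
        exact ⟨x.2, x, hx, le_rfl⟩
      · intro x _ y _ hxy
        exact Subtype.ext hxy
    rw [e1]
    refine e2.trans ?_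
    convert hc 𝓥 h𝓥 using 2 <;> first | rfl | congr 1
  obtain ⟨f, hf, hft⟩ := (Finset.all_card_le_biUnion_card_iff_exists_injective t).1 hall
  refine ⟨f, hf, fun x => ?_⟩
  have := hft x
  simp only [t, Finset.mem_filter] at this
  exact this

omit [DecidableEq E] in
/-- **The cube principle, injection form**: under the hypotheses of `card_le_of_cube`, the class
`C ∩ Qs` has an injection into itself carrying `C_R(h)` into `C_B(h)` of the image. -/
theorem exists_sw_injection_of_cube {E' : Type*} [Fintype E'] [DecidableEq E']
    (r : Config E' → Config E) (hr : Function.Injective r) (C : Finset (Config E))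
    (hC : ∀ ζ, ζ ∈ C ↔ ∃ ω, r ω = ζ) (Qs : Set (Config E)) (hEv : IsLowerSet {ω | r ω ∈ Qs}) (h : V)
    (hT : ∀ 𝓥 : Set (Set V), IsUpperSet 𝓥 → IsUpperSet {ω | cluster ends (r ω) h ∈ 𝓥})
    (hTp : ∀ 𝓥 : Set (Set V), IsUpperSet 𝓥 → IsLowerSet {ω | cluster ends (blue (r ω)) h ∈ 𝓥})
    (hswap : ∀ ω, cluster ends (r (flipAll ω)) h = cluster ends (blue (r ω)) h) :
    ∃ f : {ζ // ζ ∈ C.filter (· ∈ Qs)} → Config E, Function.Injective f ∧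
      ∀ x, f x ∈ C.filter (· ∈ Qs) ∧ cluster ends x.1 h ⊆ cluster ends (blue (f x)) h := by
  refine exists_sw_injection_of_card_le' h _ fun 𝓥 h𝓥 => ?_
  have := card_le_of_cube r hr C hC Qs hEv h hT hTp hswap h𝓥
  convert this using 2 <;> ext ζ <;> simp only [Finset.mem_filter, and_assoc]

end LocRows

end Summit.Ventures.PercRepro2
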